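import Summits.CriticalPhenomena.Ising3DConformalLimit.Theorems.StrandShadow.Negative.ClusterDecomposition
import Literature.Probability.LatticeModels.WeightedCurrentsIdentities
import Literature.Probability.LatticeModels.LoopO1
import HarnessLib

/-!
# Route `FKParityRobustness`, crux `StrandShadow` (stmt-CriticalPhenomena-14626), line
# `odd-cluster-cut-exact-helper`: nested sourceless switching in `T`-join language

Helper file 2/3 behind the registered stub `stub_oddClusterCutFirstMoment`.  For a finite graph
`G`, a subgraph `G₁` (edge set `E₁ = E(G) ∩ E(G₁)`), `β ≥ 0`, `t = tanh β` and `u ≠ v`, GIVEN the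
two-current trace dictionary of the line (the neighbouring stub `twoCurrentTraceDictionary`,
taken here as a hypothesis verbatim), we prove (`oddCutFM_nestedSwitching`, registered form
`oddCutFM_nestedSwitchingTJoin`):

`Σ_{R ∈ 𝒯_∅(E₁)} Σ_{F′ ∈ 𝒯_∅(G)} Σ_{η ⊆ E₁} t^{|R|} t^{|F′|} (t²)^{|η|} (1−t²)^{|E₁|−|η|}
     · 1[u ↔ v in R ∪ F′|_{E₁} ∪ η]  =  Z^{uv}_t(E₁) · Z^{uv}_t(G)`,

`Z^{A}_t(·) = Σ_{F ∈ 𝒯_A(·)} t^{|F|}`.  Proof: by the dictionary the left side is (up to the factor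
`cosh(β)^{|E₁|+|E|}`) the double random-current sum
`Σ 1[n₁ ⊆ E₁, ∂n₁ = ∅] 1[∂n₂ = ∅] w(n₁) w(n₂) 1[u ↔ v in E₁ through n₁ + n₂]`; the NESTED SWITCHING
LEMMA (`Current.etsum_switching_univ` of `WeightedCurrentsSwitching.lean`; Aizenman–Duminil-Copin–
Sidoravicius 2015, Lemma 2.2) moves the sources `{u,v}` into both currents, where the connection
indicator is `≡ 1` (`Current.add_mem_connIn_of_sources_eq`), and the dictionary with `g ≡ 1`
(`Σ_η w(η) = 1`, `Finset.sum_pow_mul_eq_add_pow`) evaluates the switched sum as `Z^{uv}(E₁) Z^{uv}(G)`.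

References: M. Aizenman, H. Duminil-Copin, V. Sidoravicius, Comm. Math. Phys. 334 (2015) 719–742,
Lemma 2.2 [AizenmanDuminilCopinSidoraviciusCMP2015]; H. Duminil-Copin, arXiv:1607.06933, Lemma 2.2
[DuminilCopin2016].
-/

noncomputable section

open Finset SimpleGraph
open scoped ENNReal symmDiff
open Literature.Probability.LatticeModels

namespace Summit.CriticalPhenomena.Ising3DConformalLimit.Theorems.StrandShadowOddCut

open scoped Classical
open Summit.CriticalPhenomena.Ising3DConformalLimit.StrandShadowNegative

/-! ## Part C. Nested sourceless switching in `T`-join language (from the trace dictionary) -/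

section Switching

/-- **Nested sourceless switching, `T`-join form.** Given the two-current trace dictionary, for a
finite graph `G`, a subgraph `G₁` (edge set `E₁ = E(G) ∩ E(G₁)`), `β ≥ 0`, `t = tanh β`, `u ≠ v`:
`Σ_{R ∈ 𝒯_∅(E₁)} Σ_{F′ ∈ 𝒯_∅(G)} Σ_{η ⊆ E₁} t^{|R|} t^{|F′|} (t²)^{|η|} (1−t²)^{|E₁|−|η|}
   · 1[u ↔ v in R ∪ F′|_{E₁} ∪ η] = Z^{uv}_t(E₁) · Z^{uv}_t(G)`.
Proof: by the dictionary the left side is (up to `cosh` factors) the double-current sum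
`Σ 1[n₁ ⊆ E₁, ∂n₁ = ∅] 1[∂n₂ = ∅] w w 1[u ↔ v in E₁ through n₁ + n₂]`; the nested switching
lemma (`Current.etsum_switching_univ`, ADS15 Lemma 2.2) moves the sources `{u,v}` into both
currents, where the connection indicator is `≡ 1` (`Current.add_mem_connIn_of_sources_eq`), and
the dictionary (with `g ≡ 1`, `Σ_η w(η) = 1`) evaluates the result as `Z^{uv}(E₁) Z^{uv}(G)`. -/
theorem oddCutFM_nestedSwitching
    (hDict : ∀ (V : Type) [Fintype V] [DecidableEq V] (G : SimpleGraph V) [DecidableRel G.Adj]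
      (G₁ : SimpleGraph V) [DecidableRel G₁.Adj] (β : ℝ), 0 ≤ β →
      ∀ (A B : Finset V) (g : Finset (Sym2 V) → ℝ≥0∞),
      (let E₁ : Finset (Sym2 V) := G.edgeFinset.filter fun e => e ∈ G₁.edgeSet
       let t : ℝ := Real.tanh β
       ∑' p : Current G × Current G,
          (if Current.IsSupp G₁ p.1 ∧ p.1.sources = A then p.1.eweight (fun _ => β) else 0) *
            (if p.2.sources = B then p.2.eweight (fun _ => β) else 0) *
            g (E₁.filter fun e => e ∈ (p.1 + p.2).traced)
        = ENNReal.ofReal (Real.cosh β ^ (#E₁ + #G.edgeFinset)) *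
          ∑ F ∈ tJoins G G₁.edgeSet A, ∑ F' ∈ tJoins G Set.univ B, ∑ η ∈ E₁.powerset,
            ENNReal.ofReal (t ^ #F * t ^ #F' * ((t ^ 2) ^ #η * (1 - t ^ 2) ^ (#E₁ - #η))) *
              g (F ∪ F'.filter (fun e => e ∈ G₁.edgeSet) ∪ η)))
    (V : Type) [Fintype V] [DecidableEq V] (G : SimpleGraph V) [DecidableRel G.Adj]
    (G₁ : SimpleGraph V) [DecidableRel G₁.Adj] {β : ℝ} (hβ : 0 ≤ β) {u v : V} (huv : u ≠ v) :
    ∑ F ∈ tJoins G G₁.edgeSet ∅, ∑ F' ∈ tJoins G Set.univ ∅,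
        ∑ η ∈ (G.edgeFinset.filter fun e => e ∈ G₁.edgeSet).powerset,
        (if Rch (F ∪ F'.filter (fun e => e ∈ G₁.edgeSet) ∪ η) u v then
          Real.tanh β ^ #F * Real.tanh β ^ #F' * ((Real.tanh β ^ 2) ^ #η *
            (1 - Real.tanh β ^ 2) ^ (#(G.edgeFinset.filter fun e => e ∈ G₁.edgeSet) - #η))
          else 0) =
      (∑ F ∈ tJoins G G₁.edgeSet {u, v}, Real.tanh β ^ #F) *
        ∑ F' ∈ tJoins G Set.univ {u, v}, Real.tanh β ^ #F' := by
  have hK : ∀ _e : G.edgeFinset, (0 : ℝ) ≤ β := fun _ => hβ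
  -- the two instances of the dictionary
  have hD0 := hDict V G G₁ β hβ ∅ ∅ (fun S => if Rch S u v then 1 else 0)
  have hD1 := hDict V G G₁ β hβ ({u} ∆ {v}) ({u} ∆ {v}) (fun _ => 1)
  dsimp only at hD0 hD1
  rw [pair_eq_symmDiff huv, symmDiff_comm]
  set E₁ : Finset (Sym2 V) := G.edgeFinset.filter fun e => e ∈ G₁.edgeSet with hE₁
  set t : ℝ := Real.tanh β with ht
  have ht0 : 0 ≤ t := by
    rw [ht, Real.tanh_eq_sinh_div_cosh]
    exact div_nonneg (Real.sinh_nonneg_iff.2 hβ) (Real.cosh_pos _).le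
  have ht1 : 0 ≤ 1 - t ^ 2 := sub_nonneg.2 (Real.tanh_sq_lt_one β).le
  have hw0 : ∀ F F' η : Finset (Sym2 V),
      0 ≤ t ^ #F * t ^ #F' * ((t ^ 2) ^ #η * (1 - t ^ 2) ^ (#E₁ - #η)) := fun F F' η =>
    mul_nonneg (mul_nonneg (pow_nonneg ht0 _) (pow_nonneg ht0 _))
      (mul_nonneg (pow_nonneg (sq_nonneg _) _) (pow_nonneg ht1 _))
  -- the trace test function is the connection indicator through `E(G₁)`
  have hconn : ∀ p : Current G × Current G,
      (if Rch (E₁.filter fun e => e ∈ (p.1 + p.2).traced) u v then (1 : ℝ≥0∞) else 0) =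
        (Current.connIn G₁ u v).indicator 1 (p.1 + p.2) := by
    intro p
    have hset : (↑(E₁.filter fun e => e ∈ (p.1 + p.2).traced) : Set (Sym2 V)) =
        (p.1 + p.2).tracedIn G₁ := by
      ext e
      simp only [coe_filter, hE₁, mem_filter, Set.mem_setOf_eq, Current.tracedIn,
        SimpleGraph.mem_edgeFinset]
      constructor
      · rintro ⟨⟨-, h1⟩, h2⟩
        exact ⟨h1, h2⟩
      · rintro ⟨h1, h2⟩
        exact ⟨⟨SimpleGraph.mem_edgeFinset.1 h2.1, h1⟩, h2⟩
    have hiff : Rch (E₁.filter fun e => e ∈ (p.1 + p.2).traced) u v ↔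
        p.1 + p.2 ∈ Current.connIn G₁ u v := by
      change (SimpleGraph.fromEdgeSet
          (↑(E₁.filter fun e => e ∈ (p.1 + p.2).traced) : Set (Sym2 V))).Reachable u v ↔
        (SimpleGraph.fromEdgeSet ((p.1 + p.2).tracedIn G₁)).Reachable u v
      rw [hset]
    by_cases hc : p.1 + p.2 ∈ Current.connIn G₁ u v
    · rw [Set.indicator_of_mem hc, Pi.one_apply, if_pos (hiff.2 hc)]
    · rw [Set.indicator_of_notMem hc, if_neg fun h => hc (hiff.1 h)]
  have hA : ∀ p : Current G × Current G,
      (if Current.IsSupp G₁ p.1 ∧ p.1.sources = ∅ then p.1.eweight (fun _ => β) else 0) *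
        (if p.2.sources = ∅ then p.2.eweight (fun _ => β) else 0) *
        (if Rch (E₁.filter fun e => e ∈ (p.1 + p.2).traced) u v then (1 : ℝ≥0∞) else 0) =
      (if Current.IsSupp G₁ p.1 ∧ p.1.sources = ∅ then p.1.eweight (fun _ => β) else 0) *
        (if p.2.sources = ∅ then p.2.eweight (fun _ => β) else 0) *
        ((fun _ => (1 : ℝ≥0∞)) (p.1 + p.2) * (Current.connIn G₁ u v).indicator 1 (p.1 + p.2)) := by
    intro p
    rw [hconn p, one_mul]
  have hB : ∀ p : Current G × Current G,
      (if Current.IsSupp G₁ p.1 ∧ p.1.sources = ∅ ∆ ({u} ∆ {v}) then p.1.eweight (fun _ => β)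
        else 0) * (if p.2.sources = ∅ ∆ ({u} ∆ {v}) then p.2.eweight (fun _ => β) else 0) *
        ((fun _ => (1 : ℝ≥0∞)) (p.1 + p.2) * (Current.connIn G₁ u v).indicator 1 (p.1 + p.2)) =
      (if Current.IsSupp G₁ p.1 ∧ p.1.sources = {u} ∆ {v} then p.1.eweight (fun _ => β) else 0) *
        (if p.2.sources = {u} ∆ {v} then p.2.eweight (fun _ => β) else 0) * 1 := by
    intro p
    rw [Current.empty_symmDiff]
    by_cases h1 : Current.IsSupp G₁ p.1 ∧ p.1.sources = {u} ∆ {v}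
    · rw [if_pos h1, Set.indicator_of_mem (Current.add_mem_connIn_of_sources_eq G₁ h1.1 h1.2 p.2),
        Pi.one_apply, mul_one]
    · simp only [if_neg h1, zero_mul]
  -- the chain: dictionary, switching, dictionary
  have hc0 : ENNReal.ofReal (Real.cosh β ^ (#E₁ + #G.edgeFinset)) ≠ 0 :=
    (ENNReal.ofReal_pos.2 (pow_pos (Real.cosh_pos β) _)).ne'
  have key : (∑ F ∈ tJoins G G₁.edgeSet ∅, ∑ F' ∈ tJoins G Set.univ ∅, ∑ η ∈ E₁.powerset,
      ENNReal.ofReal (t ^ #F * t ^ #F' * ((t ^ 2) ^ #η * (1 - t ^ 2) ^ (#E₁ - #η))) *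
        (if Rch (F ∪ F'.filter (fun e => e ∈ G₁.edgeSet) ∪ η) u v then (1 : ℝ≥0∞) else 0)) =
      ∑ F ∈ tJoins G G₁.edgeSet ({u} ∆ {v}), ∑ F' ∈ tJoins G Set.univ ({u} ∆ {v}),
        ∑ η ∈ E₁.powerset,
        ENNReal.ofReal (t ^ #F * t ^ #F' * ((t ^ 2) ^ #η * (1 - t ^ 2) ^ (#E₁ - #η))) * 1 := by
    apply (ENNReal.mul_right_inj hc0 ENNReal.ofReal_ne_top).1
    rw [← hD0, ← hD1, tsum_congr hA, Current.etsum_switching_univ G₁ hK ∅ ∅ u v (fun _ => 1)]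
    exact tsum_congr hB
  -- `Σ_η w(η) = 1`
  have hbin : ∑ η ∈ E₁.powerset, (t ^ 2) ^ #η * (1 - t ^ 2) ^ (#E₁ - #η) = 1 := by
    rw [Finset.sum_pow_mul_eq_add_pow, add_sub_cancel, one_pow]
  -- both sides of `key` as `ofReal` of real sums
  have hL : (∑ F ∈ tJoins G G₁.edgeSet ∅, ∑ F' ∈ tJoins G Set.univ ∅, ∑ η ∈ E₁.powerset,
      ENNReal.ofReal (t ^ #F * t ^ #F' * ((t ^ 2) ^ #η * (1 - t ^ 2) ^ (#E₁ - #η))) *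
        (if Rch (F ∪ F'.filter (fun e => e ∈ G₁.edgeSet) ∪ η) u v then (1 : ℝ≥0∞) else 0)) =
      ENNReal.ofReal (∑ F ∈ tJoins G G₁.edgeSet ∅, ∑ F' ∈ tJoins G Set.univ ∅,
        ∑ η ∈ E₁.powerset, if Rch (F ∪ F'.filter (fun e => e ∈ G₁.edgeSet) ∪ η) u v then
          t ^ #F * t ^ #F' * ((t ^ 2) ^ #η * (1 - t ^ 2) ^ (#E₁ - #η)) else 0) := by
    rw [ENNReal.ofReal_sum_of_nonneg fun F _ => sum_nonneg fun F' _ => sum_nonneg fun η _ =>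
      ite_nonneg (hw0 F F' η) le_rfl]
    refine sum_congr rfl fun F _ => ?_
    rw [ENNReal.ofReal_sum_of_nonneg fun F' _ => sum_nonneg fun η _ => ite_nonneg (hw0 F F' η) le_rfl]
    refine sum_congr rfl fun F' _ => ?_
    rw [ENNReal.ofReal_sum_of_nonneg fun η _ => ite_nonneg (hw0 F F' η) le_rfl]
    refine sum_congr rfl fun η _ => ?_
    split_ifs
    · rw [mul_one]
    · rw [mul_zero, ENNReal.ofReal_zero]
  have hR : (∑ F ∈ tJoins G G₁.edgeSet ({u} ∆ {v}), ∑ F' ∈ tJoins G Set.univ ({u} ∆ {v}),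
      ∑ η ∈ E₁.powerset,
        ENNReal.ofReal (t ^ #F * t ^ #F' * ((t ^ 2) ^ #η * (1 - t ^ 2) ^ (#E₁ - #η))) * 1) =
      ENNReal.ofReal ((∑ F ∈ tJoins G G₁.edgeSet ({u} ∆ {v}), t ^ #F) *
        ∑ F' ∈ tJoins G Set.univ ({u} ∆ {v}), t ^ #F') := by
    rw [Finset.sum_mul_sum, ENNReal.ofReal_sum_of_nonneg fun F _ => sum_nonneg fun F' _ =>
      mul_nonneg (pow_nonneg ht0 _) (pow_nonneg ht0 _)]
    refine sum_congr rfl fun F _ => ?_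
    rw [ENNReal.ofReal_sum_of_nonneg fun F' _ => mul_nonneg (pow_nonneg ht0 _) (pow_nonneg ht0 _)]
    refine sum_congr rfl fun F' _ => ?_
    simp_rw [mul_one]
    rw [← ENNReal.ofReal_sum_of_nonneg (fun η _ => hw0 F F' η), ← Finset.mul_sum, hbin, mul_one]
  rw [hL, hR, ENNReal.ofReal_eq_ofReal_iff (sum_nonneg fun F _ => sum_nonneg fun F' _ =>
    sum_nonneg fun η _ => ite_nonneg (hw0 F F' η) le_rfl) (mul_nonneg (sum_nonneg fun F _ =>
    pow_nonneg ht0 _) (sum_nonneg fun F' _ => pow_nonneg ht0 _))] at key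
  exact key

end Switching

section Registered

/-- **Nested sourceless switching, `T`-join form** (registered form of `oddCutFM_nestedSwitching`):
given the two-current trace dictionary, for `β ≥ 0`, `u ≠ v`,
`Σ_{R,F′,η} w · 1[u ↔ v in R ∪ F′|_{E₁} ∪ η] = Z^{uv}(E₁) · Z^{uv}(G)`. -/
theorem oddCutFM_nestedSwitchingTJoin :
    (∀ (V : Type) [Fintype V] [DecidableEq V] (G : SimpleGraph V) [DecidableRel G.Adj]
      (G₁ : SimpleGraph V) [DecidableRel G₁.Adj] (β : ℝ), 0 ≤ β →
      ∀ (A B : Finset V) (g : Finset (Sym2 V) → ℝ≥0∞),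
      (let E₁ : Finset (Sym2 V) := G.edgeFinset.filter fun e => e ∈ G₁.edgeSet
       let t : ℝ := Real.tanh β
       ∑' p : Current G × Current G,
          (if Current.IsSupp G₁ p.1 ∧ p.1.sources = A then p.1.eweight (fun _ => β) else 0) *
            (if p.2.sources = B then p.2.eweight (fun _ => β) else 0) *
            g (E₁.filter fun e => e ∈ (p.1 + p.2).traced)
        = ENNReal.ofReal (Real.cosh β ^ (#E₁ + #G.edgeFinset)) *
          ∑ F ∈ tJoins G G₁.edgeSet A, ∑ F' ∈ tJoins G Set.univ B, ∑ η ∈ E₁.powerset,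
            ENNReal.ofReal (t ^ #F * t ^ #F' * ((t ^ 2) ^ #η * (1 - t ^ 2) ^ (#E₁ - #η))) *
              g (F ∪ F'.filter (fun e => e ∈ G₁.edgeSet) ∪ η))) →
    ∀ (V : Type) [Fintype V] [DecidableEq V] (G : SimpleGraph V) [DecidableRel G.Adj]
      (G₁ : SimpleGraph V) [DecidableRel G₁.Adj] (β : ℝ), 0 ≤ β → ∀ (u v : V), u ≠ v →
      ∑ F ∈ tJoins G G₁.edgeSet ∅, ∑ F' ∈ tJoins G Set.univ ∅,
          ∑ η ∈ (G.edgeFinset.filter fun e => e ∈ G₁.edgeSet).powerset,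
          (if Rch (F ∪ F'.filter (fun e => e ∈ G₁.edgeSet) ∪ η) u v then
            Real.tanh β ^ #F * Real.tanh β ^ #F' * ((Real.tanh β ^ 2) ^ #η *
              (1 - Real.tanh β ^ 2) ^ (#(G.edgeFinset.filter fun e => e ∈ G₁.edgeSet) - #η))
            else 0) =
        (∑ F ∈ tJoins G G₁.edgeSet {u, v}, Real.tanh β ^ #F) *
          ∑ F' ∈ tJoins G Set.univ {u, v}, Real.tanh β ^ #F' :=
  fun hDict V _ _ G _ G₁ _ _ hβ _ _ huv => oddCutFM_nestedSwitching hDict V G G₁ hβ huv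

end Registered

end Summit.CriticalPhenomena.Ising3DConformalLimit.Theorems.StrandShadowOddCut

end
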